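import Mathlib
import HarnessLib

/-!
# ValiantsHypothesis / MonotoneRestoration — `MonotoneRestorationQP`, line `Sketch`, stub D′1

Support file for crux item `stmt-ValiantsHypothesis-15886`
(`Summit.ValiantsHypothesis.ValiantsHypothesis.Theses.MonotoneRestoration.MonotoneRestorationQP`),
line `Sketch`, stub `stub_lengthFilterRealisation` (THEOREM δ′, step D′1: the LENGTH FILTER of a
linear representation).

Setting: a linear representation (`u`, `A`, `v`) of width `w` over a field `K` of a series on words
over an alphabet `ι`: the coefficient of the word `l = [l₀, …, lₘ₋₁]` is
`u ⬝ᵥ (A l₀ * ⋯ * A lₘ₋₁) *ᵥ v`. For a fixed `n`, the LENGTH-`n` FILTER is the representation of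
width `w · (n+1)` on the index set `Fin w × Fin (n+1)` (identified with `Fin (w * (n+1))` through
`finProdFinEquiv`) given by the Kronecker products `A a ⊗ N` with the nilpotent shift
`N i j = [j = i + 1]` on `Fin (n+1)`, the covector `u ⊗ δ₀` and the vector `v ⊗ δₙ`. Along a word
`l` the product of the `A a ⊗ N` is `A(l) ⊗ N ^ |l|`, and `N ^ |l|` has the single band
`j = i + |l|`; pairing with `δ₀` and `δₙ` leaves `u ⬝ᵥ A(l) *ᵥ v` if `|l| = n` and `0` otherwise.
The entries of `A a ⊗ N` are fixed linear combinations of the entries of `A a`, uniformly in the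
letter `a`, which is the `κ`-form required by the statement. Everything is elementary matrix
algebra (Mathlib only).
-/

-- `Summit.ValiantsHypothesis.ValiantsHypothesis.…` is the tree's mandated single-conjunct layout
-- (Sub = Summit), so the duplicated namespace component is intended.
set_option linter.dupNamespace false

namespace Summit.ValiantsHypothesis.ValiantsHypothesis.Theorems

open Matrix

/-- Band structure of the shifted products: along a word `l`, the product of the matrices
`(A a ⊗ N) (p, q) = [q₂ = p₂ + 1] · A a p₁ q₁` on `Fin w × Fin (n+1)` has entries
`[q₂ = p₂ + |l|] · A(l) p₁ q₁`. [folklore] -/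
theorem lengthFilter_prod_map_apply {K ι : Type} [Field K] {w : ℕ} (n : ℕ)
    (A : ι → Matrix (Fin w) (Fin w) K) :
    ∀ (l : List ι) (p q : Fin w × Fin (n + 1)),
      (l.map fun a => Matrix.of fun p q : Fin w × Fin (n + 1) =>
          if (q.2 : ℕ) = p.2 + 1 then A a p.1 q.1 else 0).prod p q =
        if (q.2 : ℕ) = p.2 + l.length then (l.map A).prod p.1 q.1 else 0
  | [], p, q => by
    obtain ⟨p₁, p₂⟩ := p
    obtain ⟨q₁, q₂⟩ := q
    simp only [List.map_nil, List.prod_nil, List.length_nil, add_zero, Matrix.one_apply,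
      Prod.mk.injEq, Fin.ext_iff]
    by_cases h₁ : (p₁ : ℕ) = q₁ <;> by_cases h₂ : (p₂ : ℕ) = q₂ <;> simp [h₁, h₂, eq_comm]
  | a :: l, p, q => by
    obtain ⟨p₁, p₂⟩ := p
    obtain ⟨q₁, q₂⟩ := q
    rw [List.map_cons, List.prod_cons, Matrix.mul_apply, List.map_cons, List.prod_cons,
      List.length_cons]
    simp_rw [lengthFilter_prod_map_apply n A l]
    rw [Fintype.sum_prod_type]
    simp only [Matrix.of_apply]
    -- the inner sum over `k₂ : Fin (n+1)` of `[k₂ = p₂ + 1] [q₂ = k₂ + |l|]` collapses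
    have key : ∀ k₁ : Fin w,
        (∑ k₂ : Fin (n + 1), (if ((k₂ : ℕ)) = (p₂ : ℕ) + 1 then A a p₁ k₁ else 0) *
            (if (q₂ : ℕ) = (k₂ : ℕ) + l.length then (l.map A).prod k₁ q₁ else 0)) =
          if (q₂ : ℕ) = (p₂ : ℕ) + (l.length + 1) then A a p₁ k₁ * (l.map A).prod k₁ q₁
          else 0 := by
      intro k₁
      rw [Fin.sum_univ_eq_sum_range (fun k₂ : ℕ =>
        (if k₂ = (p₂ : ℕ) + 1 then A a p₁ k₁ else 0) *
          (if (q₂ : ℕ) = k₂ + l.length then (l.map A).prod k₁ q₁ else 0)) (n + 1)]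
      simp only [ite_mul, zero_mul, Finset.sum_ite_eq', Finset.mem_range]
      have hq : (q₂ : ℕ) < n + 1 := q₂.isLt
      by_cases h : (p₂ : ℕ) + 1 < n + 1
      · rw [if_pos h]
        by_cases h' : (q₂ : ℕ) = (p₂ : ℕ) + (l.length + 1)
        · rw [if_pos h', if_pos (by omega)]
        · rw [if_neg h', if_neg (by omega), mul_zero]
      · rw [if_neg h, if_neg (by omega)]
    simp_rw [key]
    by_cases h' : (q₂ : ℕ) = (p₂ : ℕ) + (l.length + 1)
    · simp only [if_pos h', Matrix.mul_apply]
    · simp only [if_neg h', Finset.sum_const_zero]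

/-- Products of simultaneously reindexed matrices along a word are the reindexed products.
[folklore] -/
theorem lengthFilter_prod_map_submatrix {K ι m o : Type} [CommRing K] [Fintype m] [Fintype o]
    [DecidableEq m] [DecidableEq o] (B : ι → Matrix m m K) (e : o ≃ m) :
    ∀ l : List ι, (l.map fun a => (B a).submatrix e e).prod = ((l.map B).prod).submatrix e e
  | [] => by simp
  | a :: l => by
    rw [List.map_cons, List.prod_cons, lengthFilter_prod_map_submatrix B e l,
      Matrix.submatrix_mul_equiv, List.map_cons, List.prod_cons]

/-- Coefficients of the length filter on the product index set: pairing the banded product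
`[q₂ = p₂ + |l|] · A(l) p₁ q₁` with `u ⊗ δ₀` on the left and `v ⊗ δₙ` on the right gives
`u ⬝ᵥ A(l) *ᵥ v` if `|l| = n` and `0` otherwise. [folklore] -/
theorem lengthFilter_dotProduct_prod_map_mulVec {K ι : Type} [Field K] {w : ℕ} (n : ℕ)
    (A : ι → Matrix (Fin w) (Fin w) K) (u v : Fin w → K) (l : List ι) :
    (fun p : Fin w × Fin (n + 1) => if p.2 = 0 then u p.1 else 0) ⬝ᵥ
        (l.map fun a => Matrix.of fun p q : Fin w × Fin (n + 1) =>
            if (q.2 : ℕ) = p.2 + 1 then A a p.1 q.1 else 0).prod *ᵥ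
          (fun q : Fin w × Fin (n + 1) => if q.2 = Fin.last n then v q.1 else 0) =
      if l.length = n then u ⬝ᵥ ((l.map A).prod).mulVec v else 0 := by
  simp only [dotProduct, Matrix.mulVec]
  simp_rw [lengthFilter_prod_map_apply n A l]
  simp only [Fintype.sum_prod_type, ite_mul, zero_mul, Finset.sum_ite_eq', Finset.mem_univ,
    if_true, mul_ite, mul_zero, Fin.val_last, Fin.val_zero, zero_add]
  by_cases hl : l.length = n
  · simp [hl, Finset.mul_sum]
  · have hl' : ¬ n = l.length := fun h => hl h.symm
    simp [hl, hl']

/-- **D′1 — LENGTH FILTER.** Every linear representation `(u, A, v)` of width `w` over a field has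
a companion representation of width `w·(n+1)` whose matrices are FIXED linear combinations of the
entries of the original ones (uniformly in the letter: `A⁺ a i j = Σ_{cd} κ i j cd · A a c d`,
namely `A a ⊗ N` for the nilpotent shift `N` on `Fin (n+1)`, reindexed) and whose coefficients are
those of `(u, A, v)` on words of length `n` and `0` on all other words. [folklore] -/
theorem stub_lengthFilterRealisation {K ι : Type} [Field K] {w : ℕ} (n : ℕ)
    (A : ι → Matrix (Fin w) (Fin w) K) (u v : Fin w → K) :
    ∃ (κ : Fin (w * (n + 1)) → Fin (w * (n + 1)) → Fin w × Fin w → K)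
      (u' v' : Fin (w * (n + 1)) → K),
      ∀ l : List ι,
        u' ⬝ᵥ ((l.map fun a => Matrix.of fun i j : Fin (w * (n + 1)) =>
            ∑ cd : Fin w × Fin w, κ i j cd * A a cd.1 cd.2).prod).mulVec v' =
          if l.length = n then u ⬝ᵥ ((l.map A).prod).mulVec v else 0 := by
  -- the identification `Fin w × Fin (n+1) ≃ Fin (w * (n+1))`
  set e : Fin w × Fin (n + 1) ≃ Fin (w * (n + 1)) := finProdFinEquiv
  refine ⟨fun i j cd => if cd = ((e.symm i).1, (e.symm j).1) then
      (if (((e.symm j).2 : Fin (n + 1)) : ℕ) = ((e.symm i).2 : ℕ) + 1 then 1 else 0) else 0,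
    fun i => if (e.symm i).2 = 0 then u (e.symm i).1 else 0,
    fun j => if (e.symm j).2 = Fin.last n then v (e.symm j).1 else 0, fun l => ?_⟩
  -- the matrices of the statement are the reindexed shifted Kronecker products
  have hM : (fun a => Matrix.of fun i j : Fin (w * (n + 1)) =>
      ∑ cd : Fin w × Fin w, (if cd = ((e.symm i).1, (e.symm j).1) then
        (if (((e.symm j).2 : Fin (n + 1)) : ℕ) = ((e.symm i).2 : ℕ) + 1 then (1 : K) else 0)
        else 0) * A a cd.1 cd.2) =
      fun a => (Matrix.of fun p q : Fin w × Fin (n + 1) =>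
        if (q.2 : ℕ) = p.2 + 1 then A a p.1 q.1 else 0).submatrix e.symm e.symm := by
    funext a
    ext i j
    simp only [Matrix.of_apply, Matrix.submatrix_apply, ite_mul, zero_mul, one_mul,
      Finset.sum_ite_eq', Finset.mem_univ, if_true]
  rw [hM, lengthFilter_prod_map_submatrix _ e.symm l, Matrix.submatrix_mulVec_equiv]
  have hu : (fun i => if (e.symm i).2 = 0 then u (e.symm i).1 else 0) =
      (fun p : Fin w × Fin (n + 1) => if p.2 = 0 then u p.1 else 0) ∘ e.symm := rfl
  have hv : ((fun j => if (e.symm j).2 = Fin.last n then v (e.symm j).1 else 0) ∘ e.symm.symm) =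
      (fun q : Fin w × Fin (n + 1) => if q.2 = Fin.last n then v q.1 else 0) := by
    funext q
    simp
  rw [hu, hv, comp_equiv_dotProduct_comp_equiv]
  exact lengthFilter_dotProduct_prod_map_mulVec n A u v l

end Summit.ValiantsHypothesis.ValiantsHypothesis.Theorems
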